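import Mathlib
import Literature.Probability.LatticeModels.HighDimPointwiseTriviality
import Summits.CriticalPhenomena.Ising3DConformalLimit.Theorems.EnergyNotSigmaSquaredMoebiusLimitExistsMoveIneq
import Summits.CriticalPhenomena.Ising3DConformalLimit.Theorems.PerfectScreeningMixedSpectralRepresentation

/-!
# Crux `CriticalTwoPointGSM`, line `Sketch` (canonical-lift spine): the joint mixed difference

Route `GaussianScaleMixture` of `Ising3DConformalLimit`, crux `CriticalTwoPointGSM`
(stmt-CriticalPhenomena-8365), line `Sketch`, canonical-lift spine (seat c1), stub
`mixedDifference_le` — a DIVIDEND of the spine (not in the composition).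

Write `G(m, w) = ⟨σ₀ σ_{(m,w)}⟩⁺_{β_c}` (`criticalTwoPoint 3 (Fin.cons m w)`) for the critical
two-point function of the nearest-neighbour Ising model on `ℤ³`, `m ∈ ℤ` the axial coordinate and
`w ∈ ℤ²` the transverse one. GIVEN rung 0 of the spine — complete monotonicity of every axial
quadratic form (the statement of the sibling stub `consForm_alternating`, taken here as the
hypothesis `halt`):

`∑_{i ≤ k} (-1)^i C(k,i) Q_v(n+i) ≥ 0`, `Q_v(m) = ∑_{x,y ∈ s} v_x v_y G(m, x - y)`,

for all finite `s ⊆ ℤ²`, real `v`, `n k ∈ ℕ` — we prove the planner's joint mixed difference at all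
heights and offsets:

`G(n+1, 0) + G(n, z) ≤ G(n, 0) + G(n+1, z)`   (`n ∈ ℕ`, `z ∈ ℤ²`),

i.e. `n ↦ G(n, 0) - G(n, z)` is nonincreasing (at `n = 1`, `z = e₁`:
`G(2,0,0) + G(1,1,0) ≤ G(1,0,0) + G(2,1,0)`, the quantity `Disproof.mixedDiff_le` derives FROM the
crux; here it holds unconditionally given rung 0, so it can never kill the crux).

Proof: if `z = 0` both sides agree. Otherwise take `k = 1`, `s = {0, z}`, `v = δ₀ - δ_z` in
`halt`: `Q_v(m) = 2 G(m, 0) - G(m, -z) - G(m, z) = 2 G(m, 0) - 2 G(m, z)` by the evenness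
`G(m, -z) = G(m, z)` (evenness of `G` composed with the sign change of the axial coordinate), and
`Q_v(n) - Q_v(n+1) ≥ 0` is the claim.

Contents: helpers in `CriticalTwoPointGSMJs.MixedDifferenceLe` (the two-point quadratic form
`pairForm_eq`, with the evenness `G(m, -z) = G(m, z)` — the sibling
`CriticalTwoPointGSMJs.JsCesaroIdentity.criticalTwoPoint_cons_neg` — reproved inline from
`criticalTwoPoint_update_neg`, `MixedSpectral.neg_cons` and `criticalTwoPoint_neg`; the case
`z ≠ 0` `of_ne_zero`), then the registered stub `mixedDifference_le`.
-/

namespace Summit.CriticalPhenomena.Ising3DConformalLimit.Theorems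

open MeasureTheory Filter Topology
open Literature.Probability.LatticeModels
open scoped BigOperators

noncomputable section

namespace CriticalTwoPointGSMJs.MixedDifferenceLe

/-! ## The quadratic form of `δ₀ - δ_z` on `{0, z}` -/

/-- **The two-point quadratic form.** For `z ≠ 0` and `v = δ₀ - δ_z` on `s = {0, z}`, at every
height `m ∈ ℤ`: `∑_{x,y ∈ {0,z}} v_x v_y G(m, x - y) = 2 G(m, 0) - 2 G(m, z)`, using the evenness
`G(m, -z) = G(m, z)` in the transverse variable (evenness of the two-point function
`G(-v) = G(v)`, `(m, -z) ↦ (-m, z)`, and the sign change of the axial coordinate). [folklore] -/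
theorem pairForm_eq (m : ℤ) {z : Fin 2 → ℤ} (hz : z ≠ 0) :
    ∑ x ∈ ({0, z} : Finset (Fin 2 → ℤ)), ∑ y ∈ ({0, z} : Finset (Fin 2 → ℤ)),
      ((if x = 0 then (1 : ℝ) else 0) - (if x = z then 1 else 0)) *
        ((if y = 0 then (1 : ℝ) else 0) - (if y = z then 1 else 0)) *
          criticalTwoPoint 3 (Fin.cons m (x - y)) =
      2 * criticalTwoPoint 3 (Fin.cons m 0) - 2 * criticalTwoPoint 3 (Fin.cons m z) := by
  -- evenness in the transverse variable: the sibling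
  -- `CriticalTwoPointGSMJs.JsCesaroIdentity.criticalTwoPoint_cons_neg`, reproved inline
  have hneg :
      criticalTwoPoint 3 (Fin.cons m (-z) : Site 3) = criticalTwoPoint 3 (Fin.cons m z) := by
    have h : (Fin.cons m (-z) : Site 3) =
        Function.update (Fin.cons (-m) (-z) : Site 3) 0 (-(Fin.cons (-m) (-z) : Site 3) 0) := by
      funext k
      refine Fin.cases ?_ (fun k => ?_) k
      · simp
      · simp
    rw [h, MoebiusLimitExistsOnlyInteraction.criticalTwoPoint_update_neg, ← MixedSpectral.neg_cons,
      criticalTwoPoint_neg]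
  rw [Finset.sum_pair hz.symm, Finset.sum_pair hz.symm, Finset.sum_pair hz.symm]
  simp only [if_true, if_neg hz, if_neg hz.symm, sub_zero, zero_sub, sub_self, hneg]
  ring

/-! ## The case `z ≠ 0` -/

/-- **The joint mixed difference, `z ≠ 0`.** Given rung 0 (`halt`), for `n ∈ ℕ` and `z ≠ 0`:
`G(n+1, 0) + G(n, z) ≤ G(n, 0) + G(n+1, z)` (`k = 1`, `s = {0, z}`, `v = δ₀ - δ_z`). [folklore] -/
theorem of_ne_zero
    (halt : ∀ (s : Finset (Fin 2 → ℤ)) (v : (Fin 2 → ℤ) → ℝ) (n k : ℕ),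
      0 ≤ ∑ i ∈ Finset.range (k + 1), (-1 : ℝ) ^ i * (k.choose i : ℝ) *
        ∑ x ∈ s, ∑ y ∈ s, v x * v y * criticalTwoPoint 3 (Fin.cons (((n + i : ℕ)) : ℤ) (x - y)))
    (n : ℕ) {z : Fin 2 → ℤ} (hz : z ≠ 0) :
    criticalTwoPoint 3 (Fin.cons (((n + 1 : ℕ)) : ℤ) 0) + criticalTwoPoint 3 (Fin.cons (n : ℤ) z) ≤
      criticalTwoPoint 3 (Fin.cons (n : ℤ) 0) +
        criticalTwoPoint 3 (Fin.cons (((n + 1 : ℕ)) : ℤ) z) := by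
  have h := halt {0, z} (fun x => (if x = 0 then (1 : ℝ) else 0) - (if x = z then 1 else 0)) n 1
  rw [Finset.sum_range_succ, Finset.sum_range_succ, Finset.sum_range_zero, pairForm_eq _ hz,
    pairForm_eq _ hz, Nat.add_zero, Nat.choose_zero_right, Nat.choose_self, Nat.cast_one, pow_zero,
    pow_one] at h
  linarith

end CriticalTwoPointGSMJs.MixedDifferenceLe

/-- **STUB `mixedDifference_le` (the planner's joint mixed difference, all heights and offsets).**
Given rung 0 (complete monotonicity of the axial quadratic forms, `halt`): for every `n ∈ ℕ` and
`z ∈ ℤ²`, `⟨σ₀σ_{(n+1,0)}⟩ + ⟨σ₀σ_{(n,z)}⟩ ≤ ⟨σ₀σ_{(n,0)}⟩ + ⟨σ₀σ_{(n+1,z)}⟩` at `β_c` — i.e.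
`n ↦ G(n,0) - G(n,z)` is nonincreasing (`k = 1`, `v = δ₀ - δ_z`); at `n = 1`, `z = e₁` this is
`G(2,0,0) + G(1,1,0) ≤ G(1,0,0) + G(2,1,0)` (`Disproof.mixedDiff_le`, there derived FROM the
crux). [folklore] -/
theorem mixedDifference_le
    (halt : ∀ (s : Finset (Fin 2 → ℤ)) (v : (Fin 2 → ℤ) → ℝ) (n k : ℕ),
      0 ≤ ∑ i ∈ Finset.range (k + 1), (-1 : ℝ) ^ i * (k.choose i : ℝ) *
        ∑ x ∈ s, ∑ y ∈ s, v x * v y * criticalTwoPoint 3 (Fin.cons (((n + i : ℕ)) : ℤ) (x - y))) :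
    ∀ (n : ℕ) (z : Fin 2 → ℤ),
      criticalTwoPoint 3 (Fin.cons (((n + 1 : ℕ)) : ℤ) 0) + criticalTwoPoint 3 (Fin.cons (n : ℤ) z) ≤
        criticalTwoPoint 3 (Fin.cons (n : ℤ) 0) + criticalTwoPoint 3 (Fin.cons (((n + 1 : ℕ)) : ℤ) z) := by
  intro n z
  by_cases hz : z = 0
  · subst hz
    exact (add_comm _ _).le
  · exact CriticalTwoPointGSMJs.MixedDifferenceLe.of_ne_zero halt n hz

end

end Summit.CriticalPhenomena.Ising3DConformalLimit.Theorems
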